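import Literature.MathematicalPhysics.QuantumFieldTheory.Balaban1983to89.B7Eq136Expansion
import Literature.MathematicalPhysics.QuantumFieldTheory.Balaban1983to89.B11Eq56Expansion

/-!
# `Balaban1983to89.B11Eq44Concrete` — T. Bałaban, *The variational problem and background fields in renormalization group method for
lattice gauge theories*, Commun. Math. Phys. **102** (1985) 277–309 [Balaban1985Variational], Sect. C pp. 285–286: **(44) «The Proposition 4
of [4] implies Q_j(ηA) = LʲηQ_jA + C_j(LʲηA), |C_j(LʲηA)| ≦ C₂(Lʲη)²|A|²» AS THE INPUT OF THE CONTRACTION ARGUMENT (49)–(56), FOR THE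
CONCRETE REMAINDER `C_j(U₀, ·)` OF [4] ON THE `ℤᵈ` CARRIER** — the hypothesis structure `B13Contraction113.QuadAnalytic` and the (56)-inputs
`C2`/`c₂`/`K₃` of `B11Eq56Expansion` INSTANTIATED, hence «exactly one fixed point» (49)–(54), the bound (55) and «D^{(2)}(A′) = C_j^{(2)}(LʲηA′)»
(56) for the concrete `C_j`

statement-level skeleton of published theorems with citation tags; proofs where landed; nothing here is a claim about the Yang–Mills mass gap

PDF held: `paper:balaban1985-cmp102-variational-background` (journal page = PDF page + 276); pp. 285–286 [PDF 9–10] read from the text layer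
`p0009.txt`/`p0010.txt`; [4] = `paper:balaban1985-cmp98-averaging` pp. 38–39.

CITATION HEADER / WHAT IS REPRODUCED.  Cell `lit-balaban`, Phase-2 proof seat p06 gen 5 = unit `lit-balaban-p06` (TAKING line HOME/STATUS.md
2026-08-21T08:10:48Z; file 4 of the `C_j⁽²⁾` lane after `B7Eq136SecondOrder`, `B7Eq136Expansion`, `B9Ineq3137From149`); SKELETON rows
**B11.Eq44** («typed-existing (B7 row); hypothesis structure `B13Contraction113.QuadAnalytic`»), **B11.Eq51** («proved (abstract complex Banach
spaces; inputs (44) = `QuadAnalytic`, ‖H‖ ≤ B₀ as hypotheses)»), **B11.Eq55** ((56) with «expansion (136) of [4] as hypotheses: symmetric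
polarization C2, … Taylor remainders K₃/K₄»); owner r08 (HOME/lit-balaban-r08/ROWS-B11.md).  THE PRINT, p. 285 [PDF 9]: *«The Proposition 4 of
[4] implies Q_j(ηA) = LʲηQ_jA + C_j(LʲηA), |C_j(LʲηA)| ≦ C₂(Lʲη)²|A|². (44)»*; *«C_j(LʲηA′ − LʲηHD(A′)) = D(A′) on Λ_j. (49) Thus the function
D(A′) is a fixed point of the transformation X → C_j(LʲηA′ − LʲηHX) on Λ_j, j = 0, 1, …, k. (50) We consider configurations A′, X with values in
the complexified Lie algebra g^c, and satisfying |A′| < ε₃(Lʲη)⁻¹ on Ω_j, X = 0 on Λ₀, |X| < ε₃/B₀ on 𝔅_k. (51)»*; p. 286 [PDF 10]: *«Hence the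
transformation is contractive if 9C₂B₀ε₃ < 1; for example we take 9C₂B₀ε₃ ≦ 1/2, i.e. ε₃ ≦ (18C₂B₀)⁻¹. The contraction maping [sic] theorem
implies that for arbitrary A′, satisfying Lʲη|A′| < ε₃ on Ω_j, there exists exactly one fixed point of the transformation (50), thus exactly one
solution of Eq. (49). … |D(A′)| = |C_j(LʲηA′ − LʲηHD(A′))| ≦ C₂(Lʲη|A′| + B₀|D(A′)|)² ≦ 4C₂|A′|²_{(−1)}. (55) This implies that a power series
expansion of D(A′) begins with second order terms. … (56) … For example we have on Λ_j D^{(2)}(A′) = C_j^{(2)}(LʲηA′), … Here C_j^{(2)}(A′, A″)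
denotes a symmetric bilinear form obtained by polarization from the quadratic form C_j^{(2)}(A), and C^{(2)}(A′) = C_j^{(2)}(LʲηA′) on Λ_j.»*
(v1.1: re-read on the render `…-p010-x2.png`; v1 had «C^{(2)}(LʲηA′)» ∕ «quadratic form C^{(2)}(A′)» for the printed `C_j^{(2)}`, and — in the
NOT-CLAIMED list below — «9C₂B₀ε₃ = ½» for the printed «9C₂B₀ε₃ ≦ 1/2», the text layer՚s OCR glyph; r08 QUOTE-AUDIT-B11 §E R4).  [4] p. 38: *«|C_k(U₀, A)| ≦ C₂|A|², (135)»*, p. 39: *«C_k(U₀, A) = C_k^{(2)}(U₀, A) + C_k^{(3)}(U₀, A) + … . (136)»*.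

DICTIONARY (tree units of the concrete [4]-files: level `j` rescaled to `ℤᵈ`, fine spacing `1`; print's `LʲηA′` on `Ω_j` ↦ `a ∈ 𝔸^S` with
the sup norm `‖a‖ = max_s ‖a_s‖`, print's `C₂(Lʲη)²|A|²` ↦ `C₂·(Lʲ)²·‖a‖²`; `S` = a finite set of fine bonds carrying the variable, `T` = a
finite set of coarse bonds `c = (z, κ)` («on Λ_j»); `𝒴 := 𝔸^S`, `𝒳 := 𝔸^T` with their sup norms ARE the abstract complex normed spaces of
`B13Contraction113`/`B11Eq56Expansion`).  `Cmap a := (C_j(U₀, ins_S a)(c))_{c∈T}` («C_j(Lʲη ·) on Λ_j»; `B7Prop5GeneralInduction.CCovIter` at the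
inserted field `B7Prop3Flat.insCfg S a`); `C2map P Q := (½·D²[C_j(U₀, ins_S ·)(c)](0)(P)(Q))_{c∈T}` — the polarization of the second-order term
of (136) (`B7Eq136SecondOrder`: its diagonal is `CCovIter2`); the operator `H` of (45)–(46) stays an ABSTRACT linear map
`Hop : 𝔸^T →ₗ[ℂ] 𝔸^S` with `‖HX‖ ≤ B₀‖X‖` exactly as in `B13Contraction113`; the regime is that of `B7Eq136SecondOrder` (a regular background
`U₀` with (52) of [4] at the top level `k`, a radius `b` with the smallness of [4] Prop. 4/Prop. 5, levels `j ≤ k`); print's `C₂` of (44)/(135)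
is `B7Eq123General`'s `8·C₁·e^{4cα₀}` (local notation `C₂` below).

WHAT THIS FILE PROVES (kernel, 0 sorry, standard axioms; two definitions with bodies + theorems).
* §1 `Cmap`, `C2map` (a genuine `𝔸^S →ₗ[ℂ] 𝔸^S →ₗ[ℂ] 𝔸^T`) and their unfolding lemmas.
* §2 **(44) AS `QuadAnalytic`, CONCRETE**: `norm_Cmap_le` (`‖Cmap a‖ ≤ C₂(Lʲ)²‖a‖²` for `‖a‖ < b` — [4] (135) at a general background,
  `B7Eq136Expansion.norm_CCovIter_slice_le`), `differentiableOn_Cmap_line` (analyticity along complex lines inside the ball — [4] Prop. 4,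
  `B7Eq136SecondOrder.analyticAt_CCovIter_ins`), **`quadAnalytic_Cmap : QuadAnalytic Cmap (C₂(Lʲ)²) b`**; and the (56)-inputs on the concrete
  carrier: `C2map_symm` («symmetric bilinear form obtained by polarization»), `C2map_self` (the diagonal is `C_j⁽²⁾`), `norm_C2map_le`
  (`‖C2map P Q‖ ≤ dC₃(Lʲ)²‖P‖‖Q‖`, from (149) for `C_j⁽²⁾`), `norm_Cmap_sub_C2map_le` (`‖Cmap a − C2map a a‖ ≤ 2C₂(Lʲ)²b⁻¹‖a‖³`, the cubic
  remainder of `B7Eq136Expansion`).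
* §3 **(49)–(56) FOR THE CONCRETE `C_j`**, by name from `B13Contraction113` (r10) and `B11Eq56Expansion` (r08):
  `exists_unique_fixedPoint_concrete` («exactly one fixed point» of `X ↦ Cmap(A′ − HX)` in the ball `‖X‖ ≤ 4C₂(Lʲ)²ε²`, for `‖A′‖ < ε`,
  `9C₂(Lʲ)²B₀ε < 1`, `3ε ≤ b`), `bound_114_concrete` ((55): `‖D(A′)‖ ≤ 4C₂(Lʲ)²‖A′‖²`), **`eq56_order2_concrete`** (`‖D(A′) − C2map A′ A′‖ ≤
  (8K₃ + 12c₂B₀C₂(Lʲ)²)‖A′‖³` with `K₃ = 2C₂(Lʲ)²b⁻¹`, `c₂ = dC₃(Lʲ)²` — «D^{(2)}(A′) = C_j^{(2)}(LʲηA′)» with an explicit cubic remainder and NO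
  hypothesis left on `C_j`), `analytic_fixedPoint_concrete` («an analytic function of A′»: along complex lines `A′_σ = P + σQ` in `‖A′_σ‖ < ε`
  the fixed points form a complex-differentiable family — `B13Contraction113.analytic_fixedPoint_113` fed with the joint analyticity of
  `C_j(U₀, ins_S ·)`).
NOT CLAIMED: the operator `H` itself ((45)–(46) = [5] Thm 3.12; abstract here, as in the rows B11.Eq45/B11.Eq51), the side condition «X = 0 on Λ₀»
of (51) (a choice of `T`), the third-order term of (56) (it needs `C_j⁽³⁾`), the numerical choice «for example we take 9C₂B₀ε₃ ≦ 1/2, i.e.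
ε₃ ≦ (18C₂B₀)⁻¹» (p. 286).

v1.1 (p06 gen 17, 2026-08-22): DOCFIX ONLY — quotations re-typed verbatim from the p. 286 render (see the note after the «THE PRINT» block above:
`C_j^{(2)}` subscripts ×5, «≦ 1/2» for the OCR «= ½», «maping [sic]»; the schematic «D = D^{(2)} + …» in `norm_Cmap_sub_C2map_le`'s docstring
un-quoted as ours); r08 `QUOTE-AUDIT-B11.md` §E item R4; declarations byte-identical.
-/

noncomputable section

open scoped BigOperators Topology
open NormedSpace Finset Metric Filter

namespace Literature.MathematicalPhysics.QuantumFieldTheory.Balaban1983to89.B11Eq44Concrete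

open B7Prop1Explicit B7Prop1Local B7Prop2Explicit B7Prop3Flat B7Prop4Flat B7Eq92Concrete B7Prop3GeneralLinear
  B7Prop4GeneralLevels B7Prop5GeneralOperators B7Prop5GeneralInduction B7Prop5GeneralLevels B7Ineq149Pairing B7Eq136SecondOrder
  B7Eq136Expansion B13Contraction113 B11Eq56Expansion

-- `Site` alone would resolve to the torus sites of `Setup.lean`; re-export the `ℤ^d` sites of `B7Prop1Explicit`.
export B7Prop1Explicit (Site)

variable {d : ℕ}

/-! ## §1 The objects: `C_j(U₀, ·)` as a map `𝔸^S → 𝔸^T` and the polarization of its second-order term -/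

section Objects

variable {𝔸 : Type*} [NormedRing 𝔸] [NormedAlgebra ℂ 𝔸] [CompleteSpace 𝔸]
variable (L : ℕ) (U₀ : Site d → Fin d → 𝔸ˣ) (S T : Finset (Site d × Fin d)) (j : ℕ)

/-- **«C_j(Lʲη ·) on Λ_j» as a map between the configuration spaces of Sect. C**: `Cmap a = (C_j(U₀, ins_S a)(c))_{c∈T} ∈ 𝔸^T` for
`a ∈ 𝔸^S` (the remainder `C_j(U₀, ·)` of [4] (134)/(136) at the field inserted on the fine bonds `S`, read on the coarse bonds `T`).
[cite: Balaban1985Variational, (44) p.285, (49)-(50) p.285] [cite: Balaban1985Averaging, (134) p.38, (136) p.39] -/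
def Cmap (a : S → 𝔸) : T → 𝔸 := fun c => CCovIter L U₀ (insCfg S a) j c.1.1 c.1.2

/-- `Cmap` unfolded at a coarse bond. [cite: Balaban1985Variational, (44) p.285] -/
theorem Cmap_apply (a : S → 𝔸) (c : T) : Cmap L U₀ S T j a c = CCovIter L U₀ (insCfg S a) j c.1.1 c.1.2 := rfl

/-- **«C_j^{(2)}(A′, A″) denotes a symmetric bilinear form obtained by polarization from the quadratic form C_j^{(2)}(A)»** — on the concrete
carrier: `C2map P Q = (½·D²[C_j(U₀, ins_S ·)(c)](0)(P)(Q))_{c∈T}`, a bilinear map `𝔸^S × 𝔸^S → 𝔸^T` (the second Fréchet derivative at the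
origin of each component of `Cmap`, halved). [cite: Balaban1985Variational, (56) p.286] [cite: Balaban1985Averaging, (136) p.39] -/
def C2map : (S → 𝔸) →ₗ[ℂ] (S → 𝔸) →ₗ[ℂ] (T → 𝔸) :=
  LinearMap.mk₂ ℂ
    (fun P Q => fun c : T =>
      (2 : ℂ)⁻¹ • fderiv ℂ (fderiv ℂ (fun a' : S → 𝔸 => CCovIter L U₀ (insCfg S a') j c.1.1 c.1.2)) 0 P Q)
    (fun P₁ P₂ Q => funext fun c => by
      simp only [map_add, add_apply, smul_add, Pi.add_apply])
    (fun t P Q => funext fun c => by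
      simp only [map_smul, smul_apply, Pi.smul_apply, smul_comm t])
    (fun P Q₁ Q₂ => funext fun c => by
      simp only [map_add, smul_add, Pi.add_apply])
    (fun t P Q => funext fun c => by
      simp only [map_smul, Pi.smul_apply, smul_comm t])

/-- `C2map` unfolded at a coarse bond. [cite: Balaban1985Variational, (56) p.286] -/
theorem C2map_apply (P Q : S → 𝔸) (c : T) :
    C2map L U₀ S T j P Q c =
      (2 : ℂ)⁻¹ • fderiv ℂ (fderiv ℂ (fun a' : S → 𝔸 => CCovIter L U₀ (insCfg S a') j c.1.1 c.1.2)) 0 P Q := rfl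

end Objects

/-! ## §2 (44) as `QuadAnalytic`, and the (56)-inputs, on the concrete carrier -/

section Regime

variable {𝔸 : Type*} [NormedRing 𝔸] [NormedAlgebra ℂ 𝔸] [CompleteSpace 𝔸] [NormOneClass 𝔸]

/-- `C₃ ≥ 0`. [folklore] -/
private theorem C3Gen_nonneg' (d L : ℕ) : 0 ≤ C3Gen d L := by
  unfold C3Gen C1ppGen; positivity

variable (L : ℕ) (hL : 2 ≤ L) {G : Subgroup 𝔸ˣ} (hG : AvgClosed d L G) (k : ℕ)
  (U₀ : Site d → Fin d → 𝔸ˣ) (hU₀ : ∀ x κ, U₀ x κ ∈ G) {α₀ : ℝ} (hα : 0 < α₀)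
  (hα3 : C0 d * α₀ ≤ 1 / 3) (hα4 : 4 * α₀ ≤ c2' d L) (h52 : pdev U₀ < α₀ * (((L : ℝ) ^ k)⁻¹) ^ 2)
  {b : ℝ} (hb : 0 < b)
  (hsmall : Real.exp (4 * (800 * ((d : ℝ) + 1) ^ 2 * ((d : ℝ) + 4)) * α₀)
    * (1 + 8 * (131072 * ((d : ℝ) + 1) ^ 2) * ((L : ℝ) ^ k * b)) ≤ 2)
  (hc₃ : 4 * ((L : ℝ) ^ k * b) < c3 d L)
  (h145 : 8 * d * thetaGen d L α₀ * (L : ℝ)⁻¹ ^ 4 ≤ 1)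
  (h155 : (2 * (L : ℝ) - 1) * (L : ℝ)⁻¹ ^ 2 + 2 * d * thetaGen d L α₀ * (L : ℝ)⁻¹ ^ 3
    + 1 / 8 * (1 + 2 * d * thetaGen d L α₀ * (L : ℝ)⁻¹ ^ 2 + 2 * d * C3Gen d L * ((L : ℝ) ^ k * b)) * (L : ℝ)⁻¹ ^ 2 ≤ 1)
  (S T : Finset (Site d × Fin d))

/-- print's `C₂` of (44) = [4] (135) at a general background (`B7Eq123General.prop4_general` (i)): `8·C₁·e^{4cα₀}`. -/
local notation "C₂" => (8 * (131072 * ((d : ℝ) + 1) ^ 2) * Real.exp (4 * (800 * ((d : ℝ) + 1) ^ 2 * ((d : ℝ) + 4)) * α₀))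

omit [NormedAlgebra ℂ 𝔸] [CompleteSpace 𝔸] [NormOneClass 𝔸] in
include hb hc₃ in
/-- the smallness `2Lᵏb ≤ c₃` of `B7Eq136Expansion` from the present `4Lᵏb < c₃`. [folklore] -/
private theorem hc₃_two : 2 * ((L : ℝ) ^ k * b) ≤ c3 d L := by
  have : 0 ≤ (L : ℝ) ^ k * b := by positivity
  linarith

include hL hG hU₀ hα hα3 hα4 h52 hb hsmall hc₃ in
/-- `Cmap 0 = 0` — «(136)» has no constant term ([4] (134)–(136): `C_j(U₀, 0) = 0`). [cite: Balaban1985Averaging, (134)–(136) pp.38–39]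
[cite: Balaban1985Variational, (55) p.286] -/
theorem Cmap_zero {j : ℕ} (hj : j ≤ k) : Cmap L U₀ S T j (0 : S → 𝔸) = 0 := by
  funext c
  rw [Cmap_apply, Pi.zero_apply]
  exact CCovIter_ins_zero L hL hG k U₀ hU₀ hα hα3 hα4 h52 hb hsmall hc₃ S hj c.1.1 c.1.2

include hL hG hU₀ hα hα3 hα4 h52 hb hsmall hc₃ in
/-- **(44) «|C_j(LʲηA)| ≦ C₂(Lʲη)²|A|²», CONCRETE**: `‖Cmap a‖ ≤ C₂·(Lʲ)²·‖a‖²` for every `a ∈ 𝔸^S` with `‖a‖ < b` — [4] (135) at the general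
regular background `U₀` (`B7Eq136Expansion.norm_CCovIter_slice_le` on the slice through `ins_S a` at `t = 1`), componentwise, hence in the
sup norm of `𝔸^T`. [cite: Balaban1985Variational, (44) p.285] [cite: Balaban1985Averaging, (135) p.38] -/
theorem norm_Cmap_le {j : ℕ} (hj : j ≤ k) {a : S → 𝔸} (ha : ‖a‖ < b) :
    ‖Cmap L U₀ S T j a‖ ≤ C₂ * ((L : ℝ) ^ j) ^ 2 * ‖a‖ ^ 2 := by
  have h0 : 0 ≤ C₂ * ((L : ℝ) ^ j) ^ 2 * ‖a‖ ^ 2 := by positivity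
  by_cases ha0 : a = 0
  · subst ha0
    rw [Cmap_zero L hL hG k U₀ hU₀ hα hα3 hα4 h52 hb hsmall hc₃ S T hj, norm_zero]
    exact h0
  have hβ : 0 < ‖a‖ := norm_pos_iff.mpr ha0
  have hB : ∀ x κ, ‖insCfg S a x κ‖ ≤ ‖a‖ := fun x κ => norm_insCfg_le S a x κ
  have h1 : (1 : ℂ) ∈ ball (0 : ℂ) (b / ‖a‖) := by
    rw [mem_ball_zero_iff, norm_one]
    exact (one_lt_div hβ).2 ha
  refine (pi_norm_le_iff_of_nonneg h0).2 fun c => ?_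
  have h := norm_CCovIter_slice_le L hL hG k U₀ hU₀ hα hα3 hα4 h52 hsmall
    (hc₃_two L k hb hc₃) hβ hB hj c.1.1 c.1.2 h1
  rw [one_smul, norm_one, one_pow, mul_one] at h
  rw [Cmap_apply]
  refine h.trans (le_of_eq ?_)
  ring

include hL hG hU₀ hα hα3 hα4 h52 hb hsmall hc₃ in
/-- **(44)'s analyticity clause («[4] Prop. 7: complex arguments»), CONCRETE**: along every complex line `ζ ↦ P + ζQ` the map `Cmap` is
complex-differentiable wherever `‖P + ζQ‖ < b` — [4] Prop. 4's analyticity of `Q_j(U₀, ·)` in the field variables at a general background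
(`B7Eq136SecondOrder.analyticAt_CCovIter_ins`), composed with the affine line, componentwise on `𝔸^T` (what the Cauchy formula (53) consumes).
[cite: Balaban1985Variational, (44) p.285, (53) p.286] [cite: Balaban1985Averaging, Prop. 4 p.38, Prop. 7 p.43] -/
theorem differentiableOn_Cmap_line {j : ℕ} (hj : j ≤ k) (P Q : S → 𝔸) :
    DifferentiableOn ℂ (fun ζ : ℂ => Cmap L U₀ S T j (P + ζ • Q)) {ζ | ‖P + ζ • Q‖ < b} := by
  intro ζ hζ
  rw [Set.mem_setOf_eq] at hζ
  refine DifferentiableAt.differentiableWithinAt ?_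
  refine differentiableAt_pi.2 fun c => ?_
  have ha : ∀ s, ‖(P + ζ • Q) s‖ ≤ b := fun s => (norm_le_pi_norm (P + ζ • Q) s).trans hζ.le
  have han := analyticAt_CCovIter_ins L hL hG k U₀ hU₀ hα hα3 hα4 h52 hb hsmall hc₃ S hj c.1.1 c.1.2 ha
  have hg : DifferentiableAt ℂ (fun ζ : ℂ => P + ζ • Q) ζ :=
    (differentiableAt_const P).add (differentiableAt_id.smul_const Q)
  have hcomp : (fun ζ : ℂ => Cmap L U₀ S T j (P + ζ • Q) c) =
      (fun a' : S → 𝔸 => CCovIter L U₀ (insCfg S a') j c.1.1 c.1.2) ∘ (fun ζ : ℂ => P + ζ • Q) := rfl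
  rw [hcomp]
  exact han.differentiableAt.comp ζ hg

include hL hG hU₀ hα hα3 hα4 h52 hb hsmall hc₃ in
/-- **(44) AS THE HYPOTHESIS STRUCTURE `QuadAnalytic` OF SECT. C, FOR THE CONCRETE `C_j(U₀, ·)`**: on the ball `‖a‖ < b` of `𝔸^S`, `Cmap` is
quadratically bounded with the constant `C₂(Lʲ)²` and analytic along complex lines — the input «(44) = [4] Prop. 4» of the rows B11.Eq44 /
B11.Eq51, no longer a hypothesis. [cite: Balaban1985Variational, (44) p.285, (49)-(55) pp.285-286] [cite: Balaban1985Averaging, Prop. 4 p.38] -/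
theorem quadAnalytic_Cmap {j : ℕ} (hj : j ≤ k) : QuadAnalytic (Cmap L U₀ S T j) (C₂ * ((L : ℝ) ^ j) ^ 2) b :=
  ⟨fun _ ha => norm_Cmap_le L hL hG k U₀ hU₀ hα hα3 hα4 h52 hb hsmall hc₃ S T hj ha,
    fun P Q => differentiableOn_Cmap_line L hL hG k U₀ hU₀ hα hα3 hα4 h52 hb hsmall hc₃ S T hj P Q⟩

include hL hG hU₀ hα hα3 hα4 h52 hb hsmall hc₃ in
/-- **the polarization is symmetric**: `C2map P Q = C2map Q P` («a symmetric bilinear form obtained by polarization»;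
`B7Eq136SecondOrder.snd_fderiv_CCovIter_ins_symm`). [cite: Balaban1985Variational, (56) p.286] -/
theorem C2map_symm {j : ℕ} (hj : j ≤ k) (P Q : S → 𝔸) : C2map L U₀ S T j P Q = C2map L U₀ S T j Q P := by
  funext c
  rw [C2map_apply, C2map_apply, snd_fderiv_CCovIter_ins_symm L hL hG k U₀ hU₀ hα hα3 hα4 h52 hb hsmall hc₃ S hj c.1.1 c.1.2 P Q]

include hL hG hU₀ hα hα3 hα4 h52 hb hsmall hc₃ in
/-- **the diagonal of the polarization is the second-order term of (136)**: `C2map a a = (C_j⁽²⁾(U₀, ins_S a)(c))_{c∈T}` («from the quadratic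
form C^{(2)}(A′)»; `B7Eq136SecondOrder.CCovIter2_ins_eq`). [cite: Balaban1985Variational, (56) p.286] [cite: Balaban1985Averaging, (136) p.39] -/
theorem C2map_self {j : ℕ} (hj : j ≤ k) (a : S → 𝔸) :
    C2map L U₀ S T j a a = fun c : T => CCovIter2 L U₀ (insCfg S a) j c.1.1 c.1.2 := by
  funext c
  rw [C2map_apply, CCovIter2_ins_eq L hL hG k U₀ hU₀ hα hα3 hα4 h52 hb hsmall hc₃ S hj c.1.1 c.1.2 a]

include hL hG hU₀ hα hα3 hα4 h52 hb hsmall hc₃ h145 h155 in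
/-- **the `c₂`-bound of the polarization**: `‖C2map P Q‖ ≤ d·C₃·(Lʲ)²·‖P‖·‖Q‖` — (149) of [4] for `C_j⁽²⁾`
(`B7Eq136SecondOrder.norm_snd_fderiv_CCovIter_ins_le`: `‖D²C_j(0)(P)(Q)‖ ≤ C₃(Lʲ)²‖P‖Σ_s kerQdd(c,s)‖Q_s‖`) and the count `Σ_s kerQdd(c,s)‖Q_s‖ ≤
2d‖Q‖` (`B7Ineq149Pairing.sum_kerQdd_mul_norm_le`). [cite: Balaban1985Variational, (56) p.286] [cite: Balaban1985Averaging, (149) p.40] -/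
theorem norm_C2map_le {j : ℕ} (hj : j ≤ k) (P Q : S → 𝔸) :
    ‖C2map L U₀ S T j P Q‖ ≤ d * (C3Gen d L * ((L : ℝ) ^ j) ^ 2) * ‖P‖ * ‖Q‖ := by
  have hL1 : 1 ≤ L := le_trans (by norm_num) hL
  have hC := C3Gen_nonneg' d L
  have h0 : 0 ≤ d * (C3Gen d L * ((L : ℝ) ^ j) ^ 2) * ‖P‖ * ‖Q‖ := by positivity
  refine (pi_norm_le_iff_of_nonneg h0).2 fun c => ?_
  rw [C2map_apply, norm_smul, norm_inv, Complex.norm_ofNat]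
  have h1 := norm_snd_fderiv_CCovIter_ins_le L hL hG k U₀ hU₀ hα hα3 hα4 h52 hb hsmall hc₃ h145 h155 S hj c.1.1 c.1.2 P Q
  have h2 := sum_kerQdd_mul_norm_le S L hL1 j c.1.1 c.1.2 Q
  have hK : 0 ≤ C3Gen d L * ((L : ℝ) ^ j) ^ 2 * ‖P‖ := by positivity
  calc 2⁻¹ * ‖fderiv ℂ (fderiv ℂ (fun a' : S → 𝔸 => CCovIter L U₀ (insCfg S a') j c.1.1 c.1.2)) 0 P Q‖
      ≤ 2⁻¹ * (C3Gen d L * ((L : ℝ) ^ j) ^ 2 * ‖P‖ * (2 * d * ‖Q‖)) :=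
        mul_le_mul_of_nonneg_left (h1.trans (mul_le_mul_of_nonneg_left h2 hK)) (by norm_num)
    _ = d * (C3Gen d L * ((L : ℝ) ^ j) ^ 2) * ‖P‖ * ‖Q‖ := by ring

include hL hG hU₀ hα hα3 hα4 h52 hb hsmall hc₃ in
/-- **the `K₃`-bound: after its second-order term, `Cmap` is cubic**: `‖Cmap a − C2map a a‖ ≤ 2C₂(Lʲ)²b⁻¹·‖a‖³` for `‖a‖ < b` (the structure `C_j = C_j⁽²⁾ + …`
of (136) of [4] beyond second order — our shorthand, not a printed display; `B7Eq136Expansion.norm_CCovIter_sub_CCovIter2_le` componentwise) — the Taylor-remainder hypothesis `h3` of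
`B11Eq56Expansion` with `K₃ = 2C₂(Lʲ)²/b`, `R = b`. [cite: Balaban1985Variational, (56) p.286] [cite: Balaban1985Averaging, (136) p.39] -/
theorem norm_Cmap_sub_C2map_le {j : ℕ} (hj : j ≤ k) {a : S → 𝔸} (ha : ‖a‖ < b) :
    ‖Cmap L U₀ S T j a - C2map L U₀ S T j a a‖ ≤ 2 * (C₂ * ((L : ℝ) ^ j) ^ 2 * b⁻¹) * ‖a‖ ^ 3 := by
  have h0 : 0 ≤ 2 * (C₂ * ((L : ℝ) ^ j) ^ 2 * b⁻¹) * ‖a‖ ^ 3 := by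
    have := hb.le
    positivity
  by_cases ha0 : a = 0
  · subst ha0
    rw [Cmap_zero L hL hG k U₀ hU₀ hα hα3 hα4 h52 hb hsmall hc₃ S T hj, LinearMap.map_zero₂, sub_zero, norm_zero]
    exact h0
  have hβ : 0 < ‖a‖ := norm_pos_iff.mpr ha0
  have hB : ∀ x κ, ‖insCfg S a x κ‖ ≤ ‖a‖ := fun x κ => norm_insCfg_le S a x κ
  rw [C2map_self L hL hG k U₀ hU₀ hα hα3 hα4 h52 hb hsmall hc₃ S T hj a]
  refine (pi_norm_le_iff_of_nonneg h0).2 fun c => ?_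
  rw [Pi.sub_apply, Cmap_apply]
  exact norm_CCovIter_sub_CCovIter2_le L hL hG k U₀ hU₀ hα hα3 hα4 h52 hb hsmall (hc₃_two L k hb hc₃) hβ hB hj
    c.1.1 c.1.2 ha

/-! ## §3 (49)–(56) for the concrete `C_j(U₀, ·)`: the contraction, (55) and (56) at order two -/

variable (Hop : (T → 𝔸) →ₗ[ℂ] (S → 𝔸)) {B₀ ε : ℝ}

include hL hG hU₀ hα hα3 hα4 h52 hb hsmall hc₃ in
/-- **(49)–(54) «there exists exactly one fixed point of the transformation (50), thus exactly one solution of Eq. (49)», FOR THE CONCRETE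
`C_j`**: for a linear `H` with `‖HX‖ ≤ B₀‖X‖` ((46) in tree units) and `A′ ∈ 𝔸^S` with `‖A′‖ < ε` ((51)), in the contraction regime
«9C₂B₀ε₃ < 1» (`9·C₂(Lʲ)²·B₀·ε < 1`) with `3ε ≤ b` (the arguments `A′ − HX` stay in the ball of (44)), the transformation `X ↦ C_j(U₀, A′ − HX)`
has EXACTLY ONE fixed point `D(A′)` in the ball `‖X‖ ≤ 4C₂(Lʲ)²ε²` of `𝔸^T` — `B13Contraction113.exists_unique_fixedPoint` fed with
`quadAnalytic_Cmap`. [cite: Balaban1985Variational, (49)-(54) pp.285-286] -/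
theorem exists_unique_fixedPoint_concrete {j : ℕ} (hj : j ≤ k) (hB₀ : 0 ≤ B₀) (hHop : ∀ X, ‖Hop X‖ ≤ B₀ * ‖X‖)
    {A' : S → 𝔸} (hA : ‖A'‖ < ε) (hq : 9 * (C₂ * ((L : ℝ) ^ j) ^ 2) * B₀ * ε < 1) (hε : 3 * ε ≤ b) :
    ∃ X ∈ closedBall (0 : T → 𝔸) (4 * (C₂ * ((L : ℝ) ^ j) ^ 2) * ε ^ 2), Cmap L U₀ S T j (A' - Hop X) = X ∧
      ∀ X' ∈ closedBall (0 : T → 𝔸) (4 * (C₂ * ((L : ℝ) ^ j) ^ 2) * ε ^ 2), Cmap L U₀ S T j (A' - Hop X') = X' → X' = X :=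
  exists_unique_fixedPoint (quadAnalytic_Cmap L hL hG k U₀ hU₀ hα hα3 hα4 h52 hb hsmall hc₃ S T hj) (by positivity) hB₀ hHop hA hq hε

include hL hG hU₀ hα hα3 hα4 h52 hb hsmall hc₃ in
/-- **(55) «|D(A′)| = |C_j(LʲηA′ − LʲηHD(A′))| ≦ C₂(Lʲη|A′| + B₀|D(A′)|)² ≦ 4C₂|A′|²_{(−1)}», FOR THE CONCRETE `C_j`**: a fixed point `X` of
`X ↦ C_j(U₀, A′ − HX)` in the ball `‖X‖ ≤ 4C₂(Lʲ)²ε²` obeys `‖X‖ ≤ 4C₂(Lʲ)²‖A′‖²` (`B13Contraction113.bound_114` fed with `quadAnalytic_Cmap`).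
[cite: Balaban1985Variational, (55) p.286] -/
theorem bound_114_concrete {j : ℕ} (hj : j ≤ k) (hB₀ : 0 ≤ B₀) (hHop : ∀ X, ‖Hop X‖ ≤ B₀ * ‖X‖)
    {A' : S → 𝔸} (hA : ‖A'‖ < ε) (hq : 9 * (C₂ * ((L : ℝ) ^ j) ^ 2) * B₀ * ε < 1) (hε : 3 * ε ≤ b)
    {X : T → 𝔸} (hX : X ∈ closedBall (0 : T → 𝔸) (4 * (C₂ * ((L : ℝ) ^ j) ^ 2) * ε ^ 2))
    (hfix : Cmap L U₀ S T j (A' - Hop X) = X) :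
    ‖X‖ ≤ 4 * (C₂ * ((L : ℝ) ^ j) ^ 2) * ‖A'‖ ^ 2 :=
  bound_114 (quadAnalytic_Cmap L hL hG k U₀ hU₀ hα hα3 hα4 h52 hb hsmall hc₃ S T hj) (by positivity) hB₀ hHop hA hq hε hX hfix

include hL hG hU₀ hα hα3 hα4 h52 hb hsmall hc₃ h145 h155 in
/-- **(56) AT ORDER TWO «D^{(2)}(A′) = C_j^{(2)}(LʲηA′)», FOR THE CONCRETE `C_j`, WITH AN EXPLICIT CUBIC REMAINDER**: a fixed point `X = D(A′)` of
`X ↦ C_j(U₀, A′ − HX)` in the ball `‖X‖ ≤ 4C₂(Lʲ)²ε²` (regime of `exists_unique_fixedPoint_concrete`) satisfies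
`‖D(A′) − C2map A′ A′‖ ≤ (8K₃ + 12c₂B₀·C₂(Lʲ)²)·‖A′‖³` with `K₃ = 2C₂(Lʲ)²b⁻¹` (`norm_Cmap_sub_C2map_le`) and `c₂ = dC₃(Lʲ)²` (`norm_C2map_le`) —
r08's `B11Eq56Expansion.eq56_order2_fixedPoint` with every hypothesis on `C_j` DISCHARGED on the concrete carrier (the case `A′ = 0` by (55):
then `X = 0`). [cite: Balaban1985Variational, (56) p.286] [cite: Balaban1985Averaging, (136) p.39, (149) p.40] -/
theorem eq56_order2_concrete {j : ℕ} (hj : j ≤ k) (hB₀ : 0 ≤ B₀) (hHop : ∀ X, ‖Hop X‖ ≤ B₀ * ‖X‖)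
    {A' : S → 𝔸} (hA : ‖A'‖ < ε) (hq : 9 * (C₂ * ((L : ℝ) ^ j) ^ 2) * B₀ * ε < 1) (hε : 3 * ε ≤ b)
    {X : T → 𝔸} (hX : X ∈ closedBall (0 : T → 𝔸) (4 * (C₂ * ((L : ℝ) ^ j) ^ 2) * ε ^ 2))
    (hfix : Cmap L U₀ S T j (A' - Hop X) = X) :
    ‖X - C2map L U₀ S T j A' A'‖ ≤
      (8 * (2 * (C₂ * ((L : ℝ) ^ j) ^ 2 * b⁻¹)) + 12 * (d * (C3Gen d L * ((L : ℝ) ^ j) ^ 2)) * B₀ * (C₂ * ((L : ℝ) ^ j) ^ 2))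
        * ‖A'‖ ^ 3 := by
  have hC := C3Gen_nonneg' d L
  have hK₃ : 0 ≤ 2 * (C₂ * ((L : ℝ) ^ j) ^ 2 * b⁻¹) := by
    have := hb.le
    positivity
  by_cases hA0 : A' = 0
  · -- `A′ = 0`: (55) gives `X = 0`, and `C2map 0 0 = 0`
    subst hA0
    have h55 := bound_114_concrete L hL hG k U₀ hU₀ hα hα3 hα4 h52 hb hsmall hc₃ S T Hop hj hB₀ hHop hA hq hε hX hfix
    rw [norm_zero, zero_pow two_ne_zero, mul_zero] at h55
    have hX0 : X = 0 := norm_le_zero_iff.1 h55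
    rw [hX0, LinearMap.map_zero₂, sub_zero, norm_zero, norm_zero, zero_pow three_ne_zero, mul_zero]
  have hApos : 0 < ‖A'‖ := norm_pos_iff.mpr hA0
  exact eq56_order2_fixedPoint (C2map L U₀ S T j)
    (quadAnalytic_Cmap L hL hG k U₀ hU₀ hα hα3 hα4 h52 hb hsmall hc₃ S T hj) hB₀ (by positivity) (by positivity) hK₃ hHop
    (fun P Q => norm_C2map_le L hL hG k U₀ hU₀ hα hα3 hα4 h52 hb hsmall hc₃ h145 h155 S T hj P Q)
    (fun Y hY => norm_Cmap_sub_C2map_le L hL hG k U₀ hU₀ hα hα3 hα4 h52 hb hsmall hc₃ S T hj hY)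
    hApos hA hq hε hX hfix

include hL hG hU₀ hα hα3 hα4 h52 hb hsmall hc₃ in
/-- **«This solution … is an analytic function of A′», FOR THE CONCRETE `C_j`** (p. 286, after (54)): along every complex line
`σ ↦ A′_σ = P + σQ` inside `‖A′_σ‖ < ε` (regime of `exists_unique_fixedPoint_concrete`) the fixed points `D(A′_σ)` form a complex-differentiable
family, each the unique fixed point in the ball `‖X‖ ≤ 4C₂(Lʲ)²ε²` and obeying (55) — `B13Contraction113.analytic_fixedPoint_113` (uniform limit
of analytic iterates) fed with `quadAnalytic_Cmap` and the joint analyticity of `C_j(U₀, ins_S ·)(c)` on the polydisc of radius `b`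
(`B7Eq136SecondOrder.analyticAt_CCovIter_ins`; the arguments `A′_σ − HX` have norm `≤ 2ε ≤ b`). [cite: Balaban1985Variational, (54) p.286]
[cite: Balaban1985Averaging, Prop. 4 p.38] -/
theorem analytic_fixedPoint_concrete {j : ℕ} (hj : j ≤ k) (hB₀ : 0 ≤ B₀) (hHop : ∀ X, ‖Hop X‖ ≤ B₀ * ‖X‖)
    (P Q : S → 𝔸) (hq : 9 * (C₂ * ((L : ℝ) ^ j) ^ 2) * B₀ * ε < 1) (hε : 3 * ε ≤ b) :
    ∃ Xs : ℂ → (T → 𝔸), DifferentiableOn ℂ Xs {σ : ℂ | ‖P + σ • Q‖ < ε} ∧ ∀ σ ∈ {σ : ℂ | ‖P + σ • Q‖ < ε},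
      Xs σ ∈ closedBall (0 : T → 𝔸) (4 * (C₂ * ((L : ℝ) ^ j) ^ 2) * ε ^ 2) ∧
      Cmap L U₀ S T j (P + σ • Q - Hop (Xs σ)) = Xs σ ∧
      (∀ X' ∈ closedBall (0 : T → 𝔸) (4 * (C₂ * ((L : ℝ) ^ j) ^ 2) * ε ^ 2),
        Cmap L U₀ S T j (P + σ • Q - Hop X') = X' → X' = Xs σ) ∧
      ‖Xs σ‖ ≤ 4 * (C₂ * ((L : ℝ) ^ j) ^ 2) * ‖P + σ • Q‖ ^ 2 := by
  have hV : IsOpen {σ : ℂ | ‖P + σ • Q‖ < ε} :=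
    isOpen_lt (continuous_const.add (continuous_id.smul continuous_const)).norm continuous_const
  have hC2' : 0 ≤ C₂ * ((L : ℝ) ^ j) ^ 2 := by positivity
  refine analytic_fixedPoint_113 (Hσ := fun _ => Hop) (Aσ := fun σ => P + σ • Q)
    (quadAnalytic_Cmap L hL hG k U₀ hU₀ hα hα3 hα4 h52 hb hsmall hc₃ S T hj) hC2' hB₀ hV
    (fun _ _ X => hHop X) (fun σ hσ => hσ) hq hε ?_
  intro g hg hgball σ hσ
  show DifferentiableWithinAt ℂ (fun σ : ℂ => Cmap L U₀ S T j (P + σ • Q - Hop (g σ))) {σ : ℂ | ‖P + σ • Q‖ < ε} σ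
  have hσ' : ‖P + σ • Q‖ < ε := hσ
  have hε0 : 0 < ε := (norm_nonneg _).trans_lt hσ'
  -- the argument `A′_σ − H g(σ)` stays in the polydisc of radius `b`
  have harg : ∀ s, ‖(P + σ • Q - Hop (g σ)) s‖ ≤ b := by
    intro s
    have hgσ : ‖g σ‖ ≤ 4 * (C₂ * ((L : ℝ) ^ j) ^ 2) * ε ^ 2 := mem_closedBall_zero_iff.1 (hgball hσ)
    have hx : 0 ≤ C₂ * ((L : ℝ) ^ j) ^ 2 * B₀ * ε := mul_nonneg (mul_nonneg hC2' hB₀) hε0.le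
    have h4 : 4 * (C₂ * ((L : ℝ) ^ j) ^ 2) * B₀ * ε ≤ 1 := by nlinarith
    have hH : ‖Hop (g σ)‖ ≤ ε := by
      refine (hHop (g σ)).trans ?_
      calc B₀ * ‖g σ‖ ≤ B₀ * (4 * (C₂ * ((L : ℝ) ^ j) ^ 2) * ε ^ 2) := mul_le_mul_of_nonneg_left hgσ hB₀
        _ = (4 * (C₂ * ((L : ℝ) ^ j) ^ 2) * B₀ * ε) * ε := by ring
        _ ≤ 1 * ε := mul_le_mul_of_nonneg_right h4 hε0.le
        _ = ε := one_mul ε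
    calc ‖(P + σ • Q - Hop (g σ)) s‖ ≤ ‖P + σ • Q - Hop (g σ)‖ := norm_le_pi_norm _ s
      _ ≤ ‖P + σ • Q‖ + ‖Hop (g σ)‖ := norm_sub_le _ _
      _ ≤ ε + ε := add_le_add hσ'.le hH
      _ ≤ b := by linarith
  -- the inner map `σ ↦ A′_σ − H g(σ)` is differentiable (`H` is bounded, hence continuous)
  have hinner : DifferentiableWithinAt ℂ (fun σ : ℂ => P + σ • Q - Hop (g σ)) {σ : ℂ | ‖P + σ • Q‖ < ε} σ := by
    have h1 : DifferentiableWithinAt ℂ (fun σ : ℂ => P + σ • Q) {σ : ℂ | ‖P + σ • Q‖ < ε} σ :=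
      ((differentiableAt_const P).add (differentiableAt_id.smul_const Q)).differentiableWithinAt
    have h2 : DifferentiableWithinAt ℂ (fun σ : ℂ => (Hop.mkContinuous B₀ hHop) (g σ)) {σ : ℂ | ‖P + σ • Q‖ < ε} σ :=
      (Hop.mkContinuous B₀ hHop).differentiableAt.comp_differentiableWithinAt σ (hg σ hσ)
    have hfun : (fun σ : ℂ => P + σ • Q - Hop (g σ)) = fun σ : ℂ => P + σ • Q - (Hop.mkContinuous B₀ hHop) (g σ) := by
      funext τ
      rw [LinearMap.mkContinuous_apply]
    rw [hfun]
    exact h1.sub h2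
  refine differentiableWithinAt_pi.2 fun c => ?_
  have han := analyticAt_CCovIter_ins L hL hG k U₀ hU₀ hα hα3 hα4 h52 hb hsmall hc₃ S hj c.1.1 c.1.2 harg
  have hcomp : (fun σ : ℂ => Cmap L U₀ S T j (P + σ • Q - Hop (g σ)) c) =
      (fun a' : S → 𝔸 => CCovIter L U₀ (insCfg S a') j c.1.1 c.1.2) ∘ (fun σ : ℂ => P + σ • Q - Hop (g σ)) := rfl
  rw [hcomp]
  exact han.differentiableAt.comp_differentiableWithinAt σ hinner

end Regime

end Literature.MathematicalPhysics.QuantumFieldTheory.Balaban1983to89.B11Eq44Concrete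

end
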